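import Summits.SmoothPoincare4.SmoothPoincare4.Theses.TwistorDissolution
import HarnessLib

/-!
# Line `birth` — BC3 skeleton for the crux `TwistorDissolution.SelfDualBlowUp` (stmt-SmoothPoincare4-11125)

Route `route-SmoothPoincare4-TwistorDissolution` (rank-3 crux EX≤4), decl
`Summit.SmoothPoincare4.SmoothPoincare4.Theses.TwistorDissolution.SelfDualBlowUp`:

  every smooth homotopy 4-sphere `M` (Hausdorff, second countable, `C^∞` atlas on `ℝ⁴`, `M ≃ₕ S⁴`)
  has `n ≤ 4` and a chain of closed smooth 4-manifolds `P 0 ≅ M`, `P (i+1) = P i # ℂℙ²` (the tree's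
  orientation-free `IsConnectedSum`, `i < n`) whose end `P n` carries a smooth orientation `o` and a
  Riemannian metric `g` (Levi-Civita) with `scal g > 0` everywhere and Hamilton's block `C` scalar in
  every `o`-positive `g`-orthonormal frame (`W⁻(o) ≡ 0`: half conformally flat of positive type).

Standing of the crux (item notes 2026-08-15/16): open problem; five refuter crux-attacks SURVIVED
(rc0, non-vacuous at `M = S⁴`, junk branch excluded by `0 < scal`, `SmoothPoincare4 → SelfDualBlowUp`
proved in evidence V.lean via `n = 0` and the round metric); grounded NEW/OPEN; modulo the known
Pedersen–Poon rigidity (route crux `PedersenPoonRigidity`, Pedersen–Poon 1994 Cor. 2.1, `τ ≤ 4`) and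
LeBrun's explicit metrics it is "ℂℙ²-dissolution at level `≤ 4`" (Manolescu–Marengon–Sarkar–Willis
2023, Question 9.12). No `Disproof.lean`, no crux workfiles, no landed
`Theorems/SelfDualBlowUp/Negative/*` (`ledger crux ls stmt-SmoothPoincare4-11125`: none, 2026-08-17);
negatives index of the summit: 0 refuted statements.

## The line: dissolve (oriented, level ≤ 4), then pull back LeBrun's metrics

The only closed 4-manifolds homeomorphic to `nℂℙ²` KNOWN to carry positive-type half-conformally-flat
metrics are the standard ones: `S⁴` (round), `ℂℙ²` (Fubini–Study), `2ℂℙ²` (Poon 1986), `nℂℙ²` for all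
`n` (LeBrun 1991, explicit hyperbolic-monopole ansatz; Donaldson–Friedman 1989, Floer 1991), always
self-dual for the orientation induced by the complex orientation of the summands; and by LeBrun 1986
(`W⁻ = 0`, `s > 0 ⇒ b⁻ = 0`) a mixed sum `kℂℙ² # lℂℙ²bar`, `k, l ≥ 1`, carries none for either
orientation. So the existence statement EX≤4 splits along the ONLY available existence engine for an
UNKNOWN homotopy sphere — "become standard first" — as

  `SelfDualBlowUp ⇐ OrientedDissolution≤4 ∧ LeBrunChainMetric`,

with a purely TOPOLOGICAL open leaf (no metric in it) and a purely GEOMETRIC known leaf (no homotopy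
sphere in it) — the converse bookkeeping of the route's own support item `DissolveOfSelfDual`
(`PedersenPoonRigidity → SelfDualBlowUp → DISSOLVE≤4`), sharpened to ORIENTED chains because the
definite pattern is exactly what the metric needs:

* `stub_orientedDissolution` — **OPEN (the bet):** for every smooth homotopy 4-sphere `M` there are
  `n ≤ 4`, a chain `P` from `M` exactly as in the crux (orientation-free `IsConnectedSum` with `ℂℙ²`),
  ONE orientation `oCP` of `ℂℙ²`, and an ORIENTED chain `(Q i, oQ i)` with `Q 0 ≅ S⁴` and
  `(Q (i+1), oQ (i+1))` the oriented connected sum `(Q i, oQ i) # (ℂℙ², oCP)` (`i < n`, the tree's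
  `IsOrientedConnectedSum`, the SAME `oCP` at every step, so `Q n ≅ n(ℂℙ², oCP) ≅ nℂℙ²` or `nℂℙ²bar`
  by uniqueness/associativity/unit of oriented sums — tree files OrientedConnectedSumUniqueness,
  OrientedConnectedSumAssoc, OrientedConnectedSumSphereSelf), with `P n ≅ Q n`.  In words:
  `M # n(εℂℙ²) ≅ n(εℂℙ²)` for some `n ≤ 4` and one sign `ε` — ℂℙ²-dissolution at level `≤ 4`, the
  `r ≤ 4` case of MMSW 2023 Question 9.12 (asked there for the balanced-presentation spheres `D(P)` and
  any `r`; known at `r = 1` for Gluck twists: `Σ_K # ℂℙ² ≅ ℂℙ²`, tree fact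
  `gluckTwist_connectedSum_complexProjectivePlane_holds`).  Implied by `SmoothPoincare4` (take `P = Q`
  the standard chain); implied by the crux via Pedersen–Poon (deep, not cheap); implies the crux only
  through stub 2; NOT known to imply `SmoothPoincare4` (that is the route's other crux
  `CP2Cancellation`, ⊇ smooth Kirby Problem 4.23).  It is also implied, modulo oriented-sum bookkeeping,
  by the sibling item `DissolvableGluck.DissolveOne` (stmt-SmoothPoincare4-17710, level `1`).  Why it
  might fail: every printed dissolution starts from a handle/sphere datum (Gluck twists, AC-trivial
  `D(P)`, cork twists) that a general `Σ` lacks; an exotic `Σ` with `Σ # nℂℙ²` exotic for all `n ≤ 4`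
  and both signs refutes it (and, with Pedersen–Poon, the crux).  Sources: ManolescuMarengonSarkarWillis2023
  (Q. 9.12), PedersenPoon1994, GompfStipsicz1999, Kirby1997 (4.23), KervaireMilnor1963 (§2).
  Size: open problem.
* `stub_leBrunChainMetric` — **KNOWN, deep (LeBrun 1991; Poon 1986 for `n = 2`; Fubini–Study,
  round; XL to formalise):** if `(Q i, oQ i)` is an oriented chain from `Q 0 ≅ S⁴` with constant
  summand orientation `oCP` as above (ANY length `n`), then every closed smooth 4-manifold `X`
  diffeomorphic to `Q n` carries a smooth orientation `o` and a Riemannian metric `g` (Levi-Civita)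
  with `scal g > 0` and block `C` scalar in `o`-positive orthonormal frames.  Proof in print:
  `Q n ≅ nℂℙ²` (or `nℂℙ²bar`, the same manifold) by Kervaire–Milnor bookkeeping; LeBrun's explicit
  self-dual conformal classes on `nℂℙ²` (zbMATH 0711.53055: "explicit half-conformally-flat metrics on
  the connected sum of any number of copies of the complex projective plane … conformal
  compactifications of asymptotically flat scalar-flat Kähler metrics", hence of positive Yamabe type;
  `n = 0, 1, 2`: round, Fubini–Study, Poon — LeBrun 2017 p. 86) contain metrics of everywhere positive
  scalar curvature and have `W⁻ = 0` for the complex orientation; pull `(o, g)` back along `X ≅ nℂℙ²`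
  (naturality of Levi-Civita and of the curvature blocks).  NO homotopy sphere occurs.  Degenerate
  case `n = 0`: `X ≅ S⁴`, round metric (`C = 2·1`, `scal = 12`, refuter evidence V.lean /
  BlockCheck.py; `ℂℙ²`: `C = 4·1` in complex-positive frames).  Why it might fail: it does not
  (published theorems); risks are formalisation size only (Fubini–Study/LeBrun metrics in the tree's
  charts, the `W⁻` computation, transport of metric data along diffeomorphisms, oriented-sum
  bookkeeping).  Expected discharge: a Literature named fact for LeBrun1991 + bookkeeping.
  Sources: LeBrun1991 (doi:10.4310/jdg/1214446999), Poon1986, DonaldsonFriedman1989, Kalafat2011,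
  LeBrun2017 (pp. 85–86), LeBrun1986, KervaireMilnor1963.
* `selfDualBlowUp_of_hyps : <stub₁-sig> → <stub₂-sig> → ∀ M …, <crux body at M>` — the composition,
  pure logic (no `sorry`, axioms `propext`/`Classical.choice`/`Quot.sound`): stub 1 yields
  `n, P, oCP, (Q, oQ)` and `P n ≅ Q n`; stub 2 applied to `X := P n` yields `(o, g)`; repackage.
  Stated pointwise so that exactly ONE theorem of the file concludes the crux by name:
* `SelfDualBlowUp_of : SelfDualBlowUp` — THE skeleton theorem: the crux BY NAME from the two declared
  stubs (the only `sorry`s of the file) through `selfDualBlowUp_of_hyps`.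

What this line adds to the summit's implication graph: the edge `OrientedDissolution≤4 ⇒ SelfDualBlowUp`
closing the circle with the route's `DissolveOfSelfDual` (`PedersenPoonRigidity → SelfDualBlowUp →
DISSOLVE≤4`): at level `≤ 4`, "positive-type twistor space after blow-ups" and "ℂℙ²-dissolution" are
the same bet, and the whole Riemannian content of EX≤4 is the KNOWN stub 2.  Disproof used: none exists
for this crux.  Dead lines: none recorded.

BC3 probes (planner folder `bc/probe_stub_orientedDissolution.lean`, `bc/probe_stub_leBrunChainMetric.lean`,
2026-08-17): for each stub, `stub → SelfDualBlowUp` and `stub → SmoothPoincare4` by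
`first | exact? | simpa | aesop` FAIL (see the line card `Lines/birth.md` for the raw outcomes);
converse directions for the record: `SmoothPoincare4 ⇒ stub 1` (true: `P = Q` standard chain; not
cheap), stub 2 is a theorem.
-/

noncomputable section

open scoped Manifold ContDiff Topology ContinuousMap Matrix

-- `Summit.<Summit>.<Problem>`: for the single-conjunct summit the duplicate segment is mandated.
set_option linter.dupNamespace false
set_option linter.unusedVariables false

namespace Summit.SmoothPoincare4.SmoothPoincare4.Cruxes.SelfDualBlowUp.Birth

open Summit.SmoothPoincare4.SmoothPoincare4.Theses.TwistorDissolution (SelfDualBlowUp)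

/-! ## The two registered stubs (`sorry` lives ONLY here) -/

/-- **Stub 1 (OPEN — the bet): oriented ℂℙ²-dissolution at level `≤ 4`.**  For every smooth homotopy
4-sphere `M` there are `n ≤ 4`, a chain `P 0 ≅ M`, `P (i+1) = P i # ℂℙ²` (`i < n`, orientation-free
`IsConnectedSum`, exactly the crux's chain), one orientation `oCP` of `ℂℙ²` and an oriented chain
`(Q i, oQ i)` from `Q 0 ≅ S⁴` with `(Q (i+1), oQ (i+1)) = (Q i, oQ i) # (ℂℙ², oCP)` (`i < n`,
`IsOrientedConnectedSum`, the same `oCP` at every step, so `Q n ≅ nℂℙ²` or `nℂℙ²bar`), such that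
`P n ≅ Q n`: `M # n(εℂℙ²) ≅ n(εℂℙ²)` for some `n ≤ 4` and one sign `ε`.  The `r ≤ 4` case of
Manolescu–Marengon–Sarkar–Willis 2023, Question 9.12 (open even for the spheres `D(P)`); known at level
`1` for Gluck twists.  Implied by `SmoothPoincare4`; implied by the crux via Pedersen–Poon 1994 Cor. 2.1;
not known to imply `SmoothPoincare4` (that is `CP2Cancellation`).  Why it might fail: all printed
dissolutions start from a handle/sphere datum a general `Σ` lacks; an exotic `Σ` with all `Σ # nℂℙ²`,
`Σ̄ # nℂℙ²` (`n ≤ 4`) exotic refutes it.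
[cite: ManolescuMarengonSarkarWillis2023, Question 9.12] [cite: PedersenPoon1994, Cor. 2.1]
[cite: KervaireMilnor1963, §2] [cite: Kirby1997, Problem 4.23] -/
theorem stub_orientedDissolution :
    ∀ (M : Type) [TopologicalSpace M] [T2Space M] [SecondCountableTopology M] [ChartedSpace (EuclideanSpace ℝ (Fin 4)) M] [IsManifold (𝓡 4) ∞ M], Nonempty (M ≃ₕ (Metric.sphere (0 : EuclideanSpace ℝ (Fin 5)) 1)) → ∃ (n : ℕ) (_ : n ≤ 4) (P : ℕ → Type) (_ : ∀ i, TopologicalSpace (P i)) (_ : ∀ i, T2Space (P i)) (_ : ∀ i, SecondCountableTopology (P i)) (_ : ∀ i, ChartedSpace (EuclideanSpace ℝ (Fin 4)) (P i)) (_ : ∀ i, IsManifold (𝓡 4) ∞ (P i)) (_ : ∀ i, CompactSpace (P i)), Nonempty (P 0 ≃ₘ⟮𝓡 4, 𝓡 4⟯ M) ∧ (∀ i < n, Literature.Topology.FourManifolds.IsConnectedSum (𝓡 4) (𝓡 4) (𝓡 4) (P i) Literature.Topology.FourManifolds.ComplexProjectivePlane (P (i + 1))) ∧ ∃ (oCP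 : Literature.Topology.FourManifolds.SmoothOrientation (𝓡 4) Literature.Topology.FourManifolds.ComplexProjectivePlane) (Q : ℕ → Type) (_ : ∀ i, TopologicalSpace (Q i)) (_ : ∀ i, T2Space (Q i)) (_ : ∀ i, SecondCountableTopology (Q i)) (_ : ∀ i, ChartedSpace (EuclideanSpace ℝ (Fin 4)) (Q i)) (_ : ∀ i, IsManifold (𝓡 4) ∞ (Q i)) (_ : ∀ i, CompactSpace (Q i)) (oQ : ∀ i, Literature.Topology.FourManifolds.SmoothOrientation (𝓡 4) (Q i)), Nonempty (Q 0 ≃ₘ⟮𝓡 4, 𝓡 4⟯ (Metric.sphere (0 : EuclideanSpace ℝ (Fin 5)) 1)) ∧ (∀ i < n, Literature.Topology.FourManifolds.IsOrientedConnectedSum (oQ i) oCP (oQ (i + 1))) ∧ Nonempty (P n ≃ₘ⟮𝓡 4, 𝓡 4⟯ Q n) := by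
  sorry

/-- **Stub 2 (KNOWN, deep — LeBrun 1991 / Poon 1986 / Fubini–Study / round, with Kervaire–Milnor
bookkeeping and transport; XL to formalise): the end of a constant-orientation ℂℙ²-chain from `S⁴`
carries a positive-type half-conformally-flat metric, and so does every manifold diffeomorphic to it.**
If `(Q i, oQ i)` is an oriented chain with `Q 0 ≅ S⁴` and `(Q (i+1), oQ (i+1)) = (Q i, oQ i) # (ℂℙ², oCP)`
for `i < n` (ANY `n`; one fixed orientation `oCP` of `ℂℙ²`), then `Q n ≅ n(ℂℙ², oCP)`, i.e. `nℂℙ²` or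
`nℂℙ²bar` — the same smooth manifold — and every closed smooth 4-manifold `X ≅ Q n` carries a smooth
orientation `o` and a Riemannian metric `g` with Levi-Civita connection, `scal g > 0` everywhere and
Hamilton's block `C` scalar in every `o`-positive `g`-orthonormal frame (`W⁻(o) ≡ 0`): LeBrun's explicit
self-dual conformal classes on `nℂℙ²` (hyperbolic-monopole ansatz; conformal compactifications of
asymptotically flat scalar-flat Kähler metrics, hence of positive Yamabe type; `n = 0, 1, 2` give the
round metric, Fubini–Study and Poon's metrics) contain metrics of positive scalar curvature and are
self-dual for the complex orientation; pull back along `X ≅ nℂℙ²`.  No homotopy sphere occurs; `n = 0`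
is the round `S⁴` (`C = 2·1`, `scal = 12`).  Why it might fail: published theorems — formalisation size
only.  [cite: LeBrun1991, Thm. p. 224 (abstract: zbl 0711.53055)] [cite: Poon1986] [cite: DonaldsonFriedman1989]
[cite: Kalafat2011] [cite: LeBrun2017, pp. 85–86] [cite: LeBrun1986] [cite: KervaireMilnor1963, §2] -/
theorem stub_leBrunChainMetric :
    ∀ (n : ℕ) (oCP : Literature.Topology.FourManifolds.SmoothOrientation (𝓡 4) Literature.Topology.FourManifolds.ComplexProjectivePlane) (Q : ℕ → Type) [∀ i, TopologicalSpace (Q i)] [∀ i, T2Space (Q i)] [∀ i, SecondCountableTopology (Q i)] [∀ i, ChartedSpace (EuclideanSpace ℝ (Fin 4)) (Q i)] [∀ i, IsManifold (𝓡 4) ∞ (Q i)] [∀ i, CompactSpace (Q i)] (oQ : ∀ i, Literature.Topology.FourManifolds.SmoothOrientation (𝓡 4) (Q i)), Nonempty (Q 0 ≃ₘ⟮𝓡 4, 𝓡 4⟯ (Metric.sphere (0 : EuclideanSpace ℝ (Fin 5)) 1)) → (∀ i < n, Literature.Topology.FourManifolds.IsOrientedConnectedSum (oQ i) oCP (oQ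 (i + 1))) → ∀ (X : Type) [TopologicalSpace X] [T2Space X] [SecondCountableTopology X] [ChartedSpace (EuclideanSpace ℝ (Fin 4)) X] [IsManifold (𝓡 4) ∞ X] [CompactSpace X], Nonempty (X ≃ₘ⟮𝓡 4, 𝓡 4⟯ Q n) → ∃ (o : Literature.Topology.FourManifolds.SmoothOrientation (𝓡 4) X) (g : Literature.Geometry.Lorentzian.PseudoRiemannianMetric (𝓡 4) ∞ (EuclideanSpace ℝ (Fin 4)) (TangentSpace (𝓡 4) : X → Type _)) (_ : g.HasLeviCivita), g.IsRiemannian ∧ (∀ x, 0 < g.scalarCurvature x) ∧ ∀ (x : X) (e : Fin 4 → TangentSpace (𝓡 4) x), g.IsOrthonormalFrame x e → o.IsPosFrame x (fun i => e (Fin.cast finrank_euclideanSpace_fin i)) → g.blockC g.leviCivita x e = ((g.blockC g.leviCivita x e).trace / 3) • (1 : Matrix (Fin 3) (Fin 3) ℝ) := by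
  sorry

/-! ## The composition: the two stubs prove the crux BY NAME (no `sorry` below this line) -/

/-- **Composition with explicit hypotheses** (the BC3 shape `stub₁-sig → stub₂-sig → crux`, stated
POINTWISE in the homotopy sphere `M` — its conclusion is the crux's body at `M` — so that exactly ONE
theorem of this file, `SelfDualBlowUp_of`, concludes the crux by name, as the skeleton lint requires):
oriented ℂℙ²-dissolution at level `≤ 4` (`hD`, stub 1) and LeBrun's metrics on the standard chain ends,
transported along `P n ≅ Q n` (`hL`, stub 2, applied to `X := P n`).  Pure logic, no `sorry`, axioms
`propext`/`Classical.choice`/`Quot.sound` only. [cite: LeBrun1991] [cite: PedersenPoon1994, Cor. 2.1] -/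
theorem selfDualBlowUp_of_hyps
    (hD : ∀ (M : Type) [TopologicalSpace M] [T2Space M] [SecondCountableTopology M] [ChartedSpace (EuclideanSpace ℝ (Fin 4)) M] [IsManifold (𝓡 4) ∞ M], Nonempty (M ≃ₕ (Metric.sphere (0 : EuclideanSpace ℝ (Fin 5)) 1)) → ∃ (n : ℕ) (_ : n ≤ 4) (P : ℕ → Type) (_ : ∀ i, TopologicalSpace (P i)) (_ : ∀ i, T2Space (P i)) (_ : ∀ i, SecondCountableTopology (P i)) (_ : ∀ i, ChartedSpace (EuclideanSpace ℝ (Fin 4)) (P i)) (_ : ∀ i, IsManifold (𝓡 4) ∞ (P i)) (_ : ∀ i, CompactSpace (P i)), Nonempty (P 0 ≃ₘ⟮𝓡 4, 𝓡 4⟯ M) ∧ (∀ i < n, Literature.Topology.FourManifolds.IsConnectedSum (𝓡 4) (𝓡 4) (𝓡 4) (P i) Literature.Topology.FourManifolds.ComplexProjectivePlane (P (i + 1))) ∧ ∃ (oCP : Literature.Topology.FourManifolds.SmoothOrientation (𝓡 4) Literature.Topology.FourManifolds.ComplexProjectivePlane) (Q : ℕ → Type) (_ : ∀ i, TopologicalSpace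 (Q i)) (_ : ∀ i, T2Space (Q i)) (_ : ∀ i, SecondCountableTopology (Q i)) (_ : ∀ i, ChartedSpace (EuclideanSpace ℝ (Fin 4)) (Q i)) (_ : ∀ i, IsManifold (𝓡 4) ∞ (Q i)) (_ : ∀ i, CompactSpace (Q i)) (oQ : ∀ i, Literature.Topology.FourManifolds.SmoothOrientation (𝓡 4) (Q i)), Nonempty (Q 0 ≃ₘ⟮𝓡 4, 𝓡 4⟯ (Metric.sphere (0 : EuclideanSpace ℝ (Fin 5)) 1)) ∧ (∀ i < n, Literature.Topology.FourManifolds.IsOrientedConnectedSum (oQ i) oCP (oQ (i + 1))) ∧ Nonempty (P n ≃ₘ⟮𝓡 4, 𝓡 4⟯ Q n))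
    (hL : ∀ (n : ℕ) (oCP : Literature.Topology.FourManifolds.SmoothOrientation (𝓡 4) Literature.Topology.FourManifolds.ComplexProjectivePlane) (Q : ℕ → Type) [∀ i, TopologicalSpace (Q i)] [∀ i, T2Space (Q i)] [∀ i, SecondCountableTopology (Q i)] [∀ i, ChartedSpace (EuclideanSpace ℝ (Fin 4)) (Q i)] [∀ i, IsManifold (𝓡 4) ∞ (Q i)] [∀ i, CompactSpace (Q i)] (oQ : ∀ i, Literature.Topology.FourManifolds.SmoothOrientation (𝓡 4) (Q i)), Nonempty (Q 0 ≃ₘ⟮𝓡 4, 𝓡 4⟯ (Metric.sphere (0 : EuclideanSpace ℝ (Fin 5)) 1)) → (∀ i < n, Literature.Topology.FourManifolds.IsOrientedConnectedSum (oQ i) oCP (oQ (i + 1))) → ∀ (X : Type) [TopologicalSpace X] [T2Space X] [SecondCountableTopology X] [ChartedSpace (EuclideanSpace ℝ (Fin 4)) X] [IsManifold (𝓡 4) ∞ X] [CompactSpace X], Nonempty (X ≃ₘ⟮𝓡 4, 𝓡 4⟯ Q n) → ∃ (o : Literature.Topology.FourManifolds.SmoothOrientation (𝓡 4) X) (g :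 Literature.Geometry.Lorentzian.PseudoRiemannianMetric (𝓡 4) ∞ (EuclideanSpace ℝ (Fin 4)) (TangentSpace (𝓡 4) : X → Type _)) (_ : g.HasLeviCivita), g.IsRiemannian ∧ (∀ x, 0 < g.scalarCurvature x) ∧ ∀ (x : X) (e : Fin 4 → TangentSpace (𝓡 4) x), g.IsOrthonormalFrame x e → o.IsPosFrame x (fun i => e (Fin.cast finrank_euclideanSpace_fin i)) → g.blockC g.leviCivita x e = ((g.blockC g.leviCivita x e).trace / 3) • (1 : Matrix (Fin 3) (Fin 3) ℝ))
    (M : Type) [TopologicalSpace M] [T2Space M] [SecondCountableTopology M]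
    [ChartedSpace (EuclideanSpace ℝ (Fin 4)) M] [IsManifold (𝓡 4) ∞ M]
    (hM : Nonempty (M ≃ₕ (Metric.sphere (0 : EuclideanSpace ℝ (Fin 5)) 1))) :
    ∃ (n : ℕ) (_ : n ≤ 4) (P : ℕ → Type) (_ : ∀ i, TopologicalSpace (P i)) (_ : ∀ i, T2Space (P i)) (_ : ∀ i, SecondCountableTopology (P i)) (_ : ∀ i, ChartedSpace (EuclideanSpace ℝ (Fin 4)) (P i)) (_ : ∀ i, IsManifold (𝓡 4) ∞ (P i)) (_ : ∀ i, CompactSpace (P i)), Nonempty (P 0 ≃ₘ⟮𝓡 4, 𝓡 4⟯ M) ∧ (∀ i < n, Literature.Topology.FourManifolds.IsConnectedSum (𝓡 4) (𝓡 4) (𝓡 4) (P i) Literature.Topology.FourManifolds.ComplexProjectivePlane (P (i + 1))) ∧ ∃ (o : Literature.Topology.FourManifolds.SmoothOrientation (𝓡 4) (P n)) (g : Literature.Geometry.Lorentzian.PseudoRiemannianMetric (𝓡 4) ∞ (EuclideanSpace ℝ (Fin 4)) (TangentSpace (𝓡 4) : P n → Type _)) (_ : g.HasLeviCivita), g.IsRiemannian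 ∧ (∀ x, 0 < g.scalarCurvature x) ∧ ∀ (x : P n) (e : Fin 4 → TangentSpace (𝓡 4) x), g.IsOrthonormalFrame x e → o.IsPosFrame x (fun i => e (Fin.cast finrank_euclideanSpace_fin i)) → g.blockC g.leviCivita x e = ((g.blockC g.leviCivita x e).trace / 3) • (1 : Matrix (Fin 3) (Fin 3) ℝ) := by
  -- stub 1: the level-`≤ 4` oriented dissolution `P n ≅ Q n ≅ n(ℂℙ², oCP)`
  obtain ⟨n, hn, P, iT, iH, iS, iC, iM, iK, hP0, hP, oCP, Q, qT, qH, qS, qC, qM, qK, oQ, hQ0, hQ, hPQ⟩ :=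
    hD M hM
  -- stub 2: LeBrun's metric on the standard end, transported to `X := P n`
  obtain ⟨o, g, hg, hRiem, hscal, hSD⟩ := hL n oCP Q oQ hQ0 hQ (P n) hPQ
  exact ⟨n, hn, P, iT, iH, iS, iC, iM, iK, hP0, hP, o, g, hg, hRiem, hscal, hSD⟩

/-- **THE SKELETON THEOREM.** The crux
`Summit.SmoothPoincare4.SmoothPoincare4.Theses.TwistorDissolution.SelfDualBlowUp`, concluded BY NAME
from the two DECLARED stubs `stub_orientedDissolution`, `stub_leBrunChainMetric` (the only `sorry`s of
the file) through the sorry-free composition `selfDualBlowUp_of_hyps`. [cite: LeBrun1991] -/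
theorem SelfDualBlowUp_of : SelfDualBlowUp := by
  intro M _ _ _ _ _ hM
  exact selfDualBlowUp_of_hyps stub_orientedDissolution stub_leBrunChainMetric M hM

end Summit.SmoothPoincare4.SmoothPoincare4.Cruxes.SelfDualBlowUp.Birth

end
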